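import Summits.BirchSwinnertonDyer.Rank1Residual.ManinAdditive.KatoShiftThreeLawsEdges
import HarnessLib
import HarnessLib.Audit.Tags

/-!
# Candidates E-es-21 / E-es-22 / E-es-23 (two residual pieces) at the prime `2`: the MULTI-SHIFT-TWIST certificate
# `KatoShiftTwistManinTwo`, the multi-shift generation law `MultiShiftClassGenerationTwo`, the archimedean residual
# `ManinOddOfPosDiscAtFour` and the `2`-torsion residual `ManinOddOfReducibleAtFour` — cell `bsd-f2-manin`
# (D-0131 (3) frontier: the Manin constant at additive primes). `@[conjecture]` leaf (NOTHING asserted; definitions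
# only; proved edges live in the sibling `KatoShiftTwoLawsEdges.lean`). The `p = 2` twin of `KatoShiftThreeLaws.lean`.

HONEST FRAMING. LENS = Euler systems / explicit reciprocity (planner `bsd-f2-manin-es` g7, HOME
`run/shared/lean/pub/bsd-f2-manin/MEMO-es.md` §19; Line file HOME/es/Line-es-kato-shift-two-reg.lean cf35a6738bf8791d,
farm rc 0 · 5 sorries = its 5 registered stubs; typing source HOME/es/T-es-10-draft.lean a2b03c487931af06 FILE 2,
VERBATIM). The lattice clause `IsLatticeOptimal D` is inlined; the multi-shift vocabulary is inlined down to the landed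
`primeClass` of `KatoShiftThreeLawsEdges` (`{0, a/ℓ}_f`), so this leaf declares nothing but `@[conjecture]` defs.

THE ROWS. **E-es-21 `KatoShiftTwistManinTwo`** (LAW on the `W[2]`-irreducible locus, no Kosters–Pannekoek hypothesis):
lattice-optimal, `4 ∣ N`, `W[2]` irreducible ⟹ `4 ∤ c`, and `2 ∤ c` if `Δ_W < 0`. MECHANISM (memo §19; composition
`katoShiftTwistManinTwo_of_shiftStep` in the Edges file, with the additive glue and the punchline PROVED): the `p = 2`
Kato fact in Néron units with the character-side condition `χ(8) ≠ 1` (tree named fact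
`Literature.NumberTheory.EllipticCurves.kato_neron_isIntegral_twistedSymbolSum_of_additive_two_polar`, derived reading;
polar invisibility at `2`) at every odd-order `χ` of `(ℤ/ℓ)^×/±1`, `ℓ ≡ 3 (mod 4)` admissible ⟹ orthogonality WITH HOLES
at `⟨8⟩` and every `⟨q⟩`, `q ∥ N`: under `2 ∣ c ∧ (Δ < 0 ∨ 4 ∣ c)` every MULTI-SHIFT class
`Σ_{T ⊆ Gen(N)} (−1)^{|T|} {0, a·∏T/ℓ}_f` has even real coordinate ⟹ with E-es-22 the real-coordinate functional is even
on an odd-index subgroup of `Λ_f` — absurd. The archimedean bit `#π₀(W(ℝ))` is why `Δ > 0` only yields `4 ∤ c`.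
**E-es-22 `MultiShiftClassGenerationTwo`** (the ONE new input; f-level form of the Line's `stub_multiShiftClass_generation`):
for `ρ̄_{W,2}` irreducible and `4 ∣ N` the multi-shift classes over admissible `ℓ ≥ ℓ₀` span a subgroup of `Λ_f` of ODD
index (f-free form, memo §19.4: the maximal Hecke-stable subspace of the annihilator of all multi-shift classes in
`H¹(X₀(N), 𝔽₂)` is the realised diamond span — every Hecke eigensystem in it is Eisenstein; no multiplicity one at `2`
is used). **E-es-23 residual pieces**: (a) `ManinOddOfPosDiscAtFour` — `W[2]` irreducible, `Δ_W > 0`: `4 ∤ c ⟹ 2 ∤ c`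
(the archimedean bit, 147/2000 curves); (b) `ManinOddOfReducibleAtFour` — `W[2]` REDUCIBLE (rational `2`-torsion),
`4 ∣ N`, lattice-optimal ⟹ `2 ∤ c` (939/2000 curves; no Euler-system mechanism). The Edges file proves, BY NAME against
the route decl, C2 `ManinOddAtFour` (stmt-BirchSwinnertonDyer-22967) ⟺ E-es-21 ∧ (a) ∧ (b) given the printed facts.

NOT IN PRINT (cell placement pending: REF2 R-es-18 asked 2026-08-27T23:09Z; the `p = 3` twins were graded: certificate
= theorem modulo a derived-reading fact + a NOT-IN-PRINT generation statement, REFUTER-ref2 finding 55). BC5 WITNESS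
(cell census = the witness of record): E-es-21 — HOME/es/E19A-SHIFT2-curves-v1.tsv 77556f0a6449d1f8 (kit j292811) · the 2000
optimal curves with `4 ∣ N ≤ 2000` · 1061/1061 `W[2]`-irreducible ones are multi-shift SHARP at an admissible prime
`ℓ ≡ 3 (4)`, `ℓ ≤ 31` · all `c = 1` · violations 0; E-es-22 — HOME/es/E19B-SHIFT2-levels-v1.tsv 055a83920c785e77 (kit j292812)
· all 196 levels `N = 4k ∈ [20, 800]` · nonEis(W*_H) = 0 at 196/196, dim W*_H = realised diamond span exactly · violations 0
(engine caveat: at 13 levels ≤ 256 some `T_q` unavailable, all with W* = diamond span already). Residuals: 147 + 939 curves,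
all `c = 1`. REFUTER VERDICTS: REF1 R-es-17 = HOME/REFUTER-ref1.md §R38 (sha16 133ebb69543afb0b, 2026-08-27T23:35Z; probe files
HOME/ref1-C45-es-g7-C2line-kst.lean b4525ee6a26e0360, ref1-C45P-es-g7-T10-probes.lean 288b1cb0f95c8269): **E-es-21 SURVIVES**
(theorem MODULO F-es-21 ∧ E-es-22), **E-es-22 SURVIVES** (law; NOTE: its `∀ ℓ₀` cofinal shape is stronger than what the lever
consumes (`ℓ₀ = 0`) and than E19B tested (`ℓ ≤ 60`) — kept at the planner's strength), **`ManinOddOfPosDiscAtFour`,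
`ManinOddOfReducibleAtFour` SURVIVE** (open, correctly residual; Ra is NOT implied by E-es-21), E-es-23 split PROVED lossless,
BC7 CLEAN ×6, KILLED 0, misstated 0; E19A sharpness reproduced by an independent engine (kit j293812: 1061/1061). REF2 R-es-18
(placement) requested 2026-08-27T23:09Z.
-/

noncomputable section

open scoped BigOperators MatrixGroups ModularForm

open CongruenceSubgroup WeierstrassCurve
  Literature.NumberTheory.EllipticCurves Literature.NumberTheory.EllipticCurves.ModularForms

namespace Summit.BirchSwinnertonDyer.Rank1Residual.ManinAdditive

/-- **E-es-21 `KatoShiftTwistManinTwo`** (LAW on the `E[2]`-irreducible locus; theorem MODULO F-es-21 and E-es-22,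
composition `katoShiftTwistManinTwo_of_shiftStep`): for a lattice-optimal datum with `4 ∣ N` and `W[2]` irreducible,
`4 ∤ c`, and `2 ∤ c` if `Δ_W < 0`.  BC5 witness: E19A (1061/1061 irreducible optimal curves with `4 ∣ N ≤ 2000` are
multi-shift sharp at an admissible prime `≤ 31`). -/
@[conjecture] def KatoShiftTwistManinTwo : Prop :=
  ∀ (W : WeierstrassCurve ℚ) [W.IsElliptic] [W.IsGloballyMinimal] {N : ℕ} [NeZero N]
    (D : ModularParametrizationData W N),
    (∀ z ∈ D.L.lattice, ∃ w ∈ periodLattice D.f, z = D.c * w) → 2 ^ 2 ∣ N →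
    W.HasIrreducibleModPGaloisRep 2 → ¬ (4 : ℤ) ∣ D.c ∧ (W.Δ < 0 → ¬ (2 : ℤ) ∣ D.c)

/-- **E-es-22 `MultiShiftClassGenerationTwo`** (CONJECTURE, f-level form; BC5 witness E19B 196/196 levels
`N = 4k ≤ 800`): for `W[2]` irreducible and `4 ∣ N`, the multi-shift classes
`Σ_{T ⊆ Gen(N)} (−1)^{|T|} {0, a·∏T/ℓ}_f`, `Gen(N) = {8} ∪ {q ∥ N}`, over admissible primes `ℓ ≥ ℓ₀`
(`ℓ ∤ N`, `ℓ ≡ 3 (mod 4)`, no `t ∈ Gen(N)` is `±1 mod ℓ`) span a subgroup of `Λ_f` of ODD index.  Structured form: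
`multiShiftClassGenerationTwo_iff` (Edges). -/
@[conjecture] def MultiShiftClassGenerationTwo : Prop :=
  ∀ (W : WeierstrassCurve ℚ) [W.IsElliptic] {N : ℕ} [NeZero N] (f : CuspForm (Gamma0 N) 2) (ℓ₀ : ℕ),
    IsNewformOf W f → 2 ^ 2 ∣ N → W.HasIrreducibleModPGaloisRep 2 →
    ∃ m : ℕ, ¬ 2 ∣ m ∧ ∀ z ∈ periodLattice f, (m : ℂ) * z ∈ AddSubgroup.closure
      {z : ℂ | ∃ ℓ ∈ {ℓ : ℕ | ℓ₀ ≤ ℓ ∧ (ℓ.Prime ∧ ¬ ℓ ∣ N ∧ ℓ % 4 = 3 ∧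
          ∀ t ∈ insert 8 (N.primeFactors.filter fun q => ¬ q ^ 2 ∣ N),
            (t : ZMod ℓ) ≠ 1 ∧ (t : ZMod ℓ) ≠ -1)},
        ∃ a : ℕ, 0 < a ∧ a < ℓ ∧
          z = ∑ T ∈ (insert 8 (N.primeFactors.filter fun q => ¬ q ^ 2 ∣ N)).powerset,
                (-1 : ℂ) ^ T.card * primeClass f ℓ (a * ∏ t ∈ T, t)}

/-- **E-es-23 (a), the ARCHIMEDEAN RESIDUAL `ManinOddOfPosDiscAtFour`**: `W[2]` irreducible, `Δ_W > 0`, `4 ∣ N`,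
lattice-optimal, `4 ∤ c ⟹ 2 ∤ c` (the bit `#π₀(W(ℝ)) = 2` that Kato's value `T·L_S/Ω₁` cannot see; 147/2000 curves). -/
@[conjecture] def ManinOddOfPosDiscAtFour : Prop :=
  ∀ (W : WeierstrassCurve ℚ) [W.IsElliptic] [W.IsGloballyMinimal] {N : ℕ} [NeZero N]
    (D : ModularParametrizationData W N),
    (∀ z ∈ D.L.lattice, ∃ w ∈ periodLattice D.f, z = D.c * w) → 2 ^ 2 ∣ N →
    W.HasIrreducibleModPGaloisRep 2 → 0 < W.Δ → ¬ (4 : ℤ) ∣ D.c → ¬ (2 : ℤ) ∣ D.c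

/-- **E-es-23 (b), the 2-TORSION RESIDUAL `ManinOddOfReducibleAtFour`**: `W[2]` reducible (rational 2-torsion),
`4 ∣ N`, lattice-optimal ⟹ `2 ∤ c` (939/2000 curves; no mechanism in the Euler-system lens). -/
@[conjecture] def ManinOddOfReducibleAtFour : Prop :=
  ∀ (W : WeierstrassCurve ℚ) [W.IsElliptic] [W.IsGloballyMinimal] {N : ℕ} [NeZero N]
    (D : ModularParametrizationData W N),
    (∀ z ∈ D.L.lattice, ∃ w ∈ periodLattice D.f, z = D.c * w) → 2 ^ 2 ∣ N →
    ¬ W.HasIrreducibleModPGaloisRep 2 → ¬ (2 : ℤ) ∣ D.c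

end Summit.BirchSwinnertonDyer.Rank1Residual.ManinAdditive

end
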